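import Summits.ResolutionOfSingularities.ResolutionOfSingularities.Theorems.WildConesCampaignW46ForcedAtomFiniteStep
import Summits.ResolutionOfSingularities.ResolutionOfSingularities.Theorems.WildConesCampaignW46ForcedAtomExitBound
import HarnessLib

/-!
# [OURS · L1 W4.6, rung (i)/(all `n ≥ 1`)] The forced-atom rungs over every FINITE field: termination (résumé-free and
# typed) for all `n ≥ 1`, and the Milnor exit bound for `n ≤ 2 ∨ p = 2`
# (cell res-hironaka, LADDER-RESOLUTION rung L, D-0089; slot W4.6, seat res-L1-s46-pv-2 gen 3; host route `WildCones`,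
# crux `ClassicalRegimes` stmt-ResolutionOfSingularities-16884, `--supports … --as helper`)

HONEST FRAMING. Everything here is OURS. NOTHING below is a statement of H. Hironaka's manuscript [Hironaka2017] and
nothing asserts that any statement of it holds: the typed procedure and its résumé-free / finite-sequence forms
(`CampaignW46.Run`/`Terminates` — res-L1-type-o1; `PermissibleRun`/`PermissiblyTerminates`/`FinPermissibleRun`/
`FinLocalExitBound` — res-L1-s46-pv-1 / o1), o1's regime `Regime.forcedAtom` (p517839) and the typed candidate carriers of
row 001 enter as DEFINITIONS; no FACT-LIST premise is used. AI review is weaker than expert review.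

## What is proved — the rungs of p523688 / p524336 / p517839 with «`K` algebraically closed» replaced by «`K` FINITE»

* `permissiblyTerminates_forcedAtom_of_finite (hK : Finite K) (hn : 0 < n)` — no infinite §2.1-permissible sequence inside
  `Regime.forcedAtom n` over a FINITE field `K` of characteristic `p`; `forcedAtomTerminates_of_finite` /
  `forcedAtomTerminatesNabla_of_finite` — o1's `ForcedAtomTerminates[Nabla] p K n` for finite `K` (every `N`, `Rd`);
* `finLocalExitBound_forcedAtom_of_finite (hK : Finite K) (hn : 0 < n) (hreg : n ≤ 2 ∨ p = 2)` — the Milnor exit bound over a finite field;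
* summary forms `…_of_isAlgClosed_or_finite (hK : IsAlgClosed K ∨ Finite K)` of all three (with p523688 / p524336).

Proofs verbatim those of p523688 / p524336 with the one step `exists_presentation_transform_of_finite` (brick 17,
`…ForcedAtomFiniteStep.lean`): in the regime every stage's singular stalk is presented, so its residue field is `K`
(brick 16), which is all the finite-field one step needs. Finite fields are where the slot's kill test K4.6 computes
(res-L0-k46: the cusp family `y^p + xⁿ` over prime fields); this seat's witnesses `CuspPlane.regime_forcedAtom` /
`SurfacePlane.regime_forcedAtom` (p521837 / p522706, every perfect field) show the regime inhabited over them.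

NOT claimed: infinite perfect non-closed `K`; `n = 0`; a number for `n ≥ 3`, `p` odd. References: p523688, p524336,
bricks 16/17, res-L1-type-o1 p517839/p488284, res-L1-s46-pv-1 p469934. [folklore]
-/

noncomputable section

-- single-problem summit: the doubled namespace component `ResolutionOfSingularities` is forced
set_option linter.dupNamespace false

open scoped BigOperators Classical
open MvPowerSeries IsLocalRing

namespace Summit.ResolutionOfSingularities.ResolutionOfSingularities.Theorems

namespace CampaignW46.ForcedAtom

open CategoryTheory AlgebraicGeometry TopologicalSpace
open Literature.AlgebraicGeometry.Resolution
open Literature.AlgebraicGeometry.Hironaka2017.S02Preliminaries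
open Literature.AlgebraicGeometry.Hironaka2017.Datum
open Scheme.IdealSheafData
open WildCones
open CampaignW46.AtomGerm

variable {p : ℕ} [Fact p.Prime] {K : Type} [Field K] [CharP K p] {n : ℕ}

/-! ## The rungs over a finite field -/

section FiniteField

/-- [OURS · L1 W4.6, rung (i)/(all `n ≥ 1`) over FINITE fields — RÉSUMÉ-FREE; NOT a statement of the manuscript]
**Over a finite field `K` of characteristic `p`, `0 < n`, there is no infinite §2.1-permissible sequence of blow-ups all
of whose stages lie in `Regime.forcedAtom n`.** Proof verbatim that of `permissiblyTerminates_forcedAtom` (p523688) with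
the one step `exists_presentation_transform_of_finite`. [folklore] -/
theorem permissiblyTerminates_forcedAtom_of_finite (hK : Finite K) (hn : 0 < n) :
    PermissiblyTerminates (Regime.forcedAtom (p := p) (K := K) n) := by
  haveI := hK
  intro r hr
  have hp : p.Prime := Fact.out
  have hS : ∀ k, (r.E k).sing.Subsingleton := fun k => (hr k).2.1
  -- in the regime every permissible centre is the singular point
  have hcen : ∀ k, ∃ ξ : (r.A k).Z, (r.D k : Set (r.A k).Z) = {ξ} ∧ (r.E k).sing = {ξ} := by
    intro k
    obtain ⟨ξ, hξD⟩ := (r.permissible k).irreducible.nonempty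
    have hξS : ξ ∈ (r.E k).sing := (r.permissible k).subset_sing hξD
    refine ⟨ξ, ?_, (hS k).eq_singleton_of_mem hξS⟩
    exact (Set.subsingleton_of_subset_singleton
      (((hS k).eq_singleton_of_mem hξS) ▸ (r.permissible k).subset_sing)).eq_singleton_of_mem hξD
  choose ξ hξ using hcen
  have hξS : ∀ k, ξ k ∈ (r.E k).sing := fun k => by
    rw [(hξ k).2]
    exact Set.mem_singleton _
  -- every stalk at a singular point is presented, so its residue field is `K`
  have hres : ∀ k, Nonempty (ResidueField ((r.A k).Z.presheaf.stalk (ξ k)) ≃+* K) := fun k => by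
    haveI : IsRegularLocalRing ((r.A k).Z.presheaf.stalk (ξ k)) := ambient_isRegular (r.A k) _
    obtain ⟨E₀, -, -, -, -⟩ := ((hr k).2.2 (ξ k) (hξS k)).2.1
    exact nonempty_residueField_equiv_of_presentation E₀
  -- multiplicity `p` of a presented atom is read off `ξ_k ∈ Sing(E_k)` (and `ser ≠ 0` off isolatedness)
  have hmult : ∀ (k : ℕ)
      (E₀ : AdicCompletion (maximalIdeal ((r.A k).Z.presheaf.stalk (ξ k))) ((r.A k).Z.presheaf.stalk (ξ k)) ≃+*
        MvPowerSeries (Option (Fin n)) K)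
      (f₀ : (r.A k).Z.presheaf.stalk (ξ k)) (a : (Fin n → ℕ) → K) (w : MvPowerSeries (Option (Fin n)) K),
      stalkIdeal (r.E k).J (ξ k) = Ideal.span {f₀} → IsUnit w →
        E₀ (algebraMap _ _ f₀) = w * ((X none : MvPowerSeries (Option (Fin n)) K) ^ p -
          rename (some : Fin n → Option (Fin n)) (ser p n K a)) → MultP p n K a := by
    intro k E₀ f₀ a w hJ hw hf₀
    haveI : IsRegularLocalRing ((r.A k).Z.presheaf.stalk (ξ k)) := ambient_isRegular (r.A k) _
    have hI : Isol p n K a := ((hr k).2.2 (ξ k) (hξS k)).2.2 E₀ f₀ a w hJ hw hf₀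
    have hf₀𝔪 : f₀ ∈ maximalIdeal ((r.A k).Z.presheaf.stalk (ξ k)) ^ p := by
      have h := hξS k
      change ((r.E k).b : ℕ∞) ≤ idealOrder (r.E k).J _ at h
      rw [le_idealOrder_iff, hJ, Ideal.span_singleton_le_iff_mem, (hr k).1] at h
      exact h
    exact (transform_mem_pow_iff_multP E₀ hw a hf₀).2.mpr ⟨ThreefoldsCharTwo.ser_ne_zero_of_isol hn hI, hf₀𝔪⟩
  -- presentations at `ξ_k`, and the one-step transition
  let P : ℕ → Type := fun k =>
    Σ' (E₀ : AdicCompletion (maximalIdeal ((r.A k).Z.presheaf.stalk (ξ k))) ((r.A k).Z.presheaf.stalk (ξ k)) ≃+*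
        MvPowerSeries (Option (Fin n)) K)
      (f₀ : (r.A k).Z.presheaf.stalk (ξ k)) (a : (Fin n → ℕ) → K) (w : MvPowerSeries (Option (Fin n)) K),
      stalkIdeal (r.E k).J (ξ k) = Ideal.span {f₀} ∧ IsUnit w ∧
        E₀ (algebraMap _ _ f₀) = w * ((X none : MvPowerSeries (Option (Fin n)) K) ^ p -
          rename (some : Fin n → Option (Fin n)) (ser p n K a))
  have hnext : ∀ (k : ℕ) (q : P k), ∃ (i₀ : Fin n) (t : Fin n → K) (q' : P (k + 1)),
      q'.2.2.1 = step p n K i₀ t q.2.2.1 := by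
    intro k q
    obtain ⟨E₀, f₀, a, w, hJ, hw, hf₀⟩ := q
    have hd := ((hr k).2.2 (ξ k) (hξS k)).1
    have hξ' : ξ (k + 1) ∈ ((r.E k).transform (r.π k) (r.D k)).sing := by
      rw [← r.E_succ k]
      exact hξS (k + 1)
    obtain ⟨i₀, t, E₀', f₀', w', hJ', hw', hf₀'⟩ := exists_presentation_transform_of_finite (r.π k) (r.D k)
      (r.blowup k) (hr k).1 (hS k) (hξS k) (hξ k).1 hd E₀ f₀ a w hJ hw hf₀
      (hmult k E₀ f₀ a w hJ hw hf₀) hξ' (hres (k + 1))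
    refine ⟨i₀, t, ⟨E₀', f₀', step p n K i₀ t a, w', ?_, hw', hf₀'⟩, rfl⟩
    rw [r.E_succ k]
    exact hJ'
  choose inext tnext qnext hnext using hnext
  -- the initial presentation and the induced sequence of presentations
  obtain ⟨E₀, f₀, c₀, w₀, hJ0, hw0, hf0⟩ := ((hr 0).2.2 (ξ 0) (hξS 0)).2.1
  let q0 : P 0 := ⟨E₀, f₀, c₀, w₀, hJ0, hw0, hf0⟩
  let sq : ∀ k, P k := fun k => Nat.rec (motive := fun k => P k) q0 (fun k q => qnext k q) k
  have hsq : ∀ k, sq (k + 1) = qnext k (sq k) := fun k => rfl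
  -- the induced run of the coefficient calculus
  have hrun : ∀ k, run p n K c₀ (fun k => inext k (sq k)) (fun k => tnext k (sq k)) k = (sq k).2.2.1 := by
    intro k
    induction k with
    | zero => rfl
    | succ k ih =>
      rw [hsq, hnext k (sq k), ← ih]
      rfl
  -- every state is isolated of multiplicity `p`: contradiction with the proved target of `WildCones`
  have hnot : ¬ InfRun p n K c₀ (fun k => inext k (sq k)) (fun k => tnext k (sq k)) :=
    IsolatedForcedTermination_proof p hp n hn K c₀ _ _
  refine hnot fun k => ?_
  rw [hrun k]
  obtain ⟨E₀, f₀, a, w, hJ, hw, hf₀⟩ := sq k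
  exact ⟨((hr k).2.2 (ξ k) (hξS k)).2.2 E₀ f₀ a w hJ hw hf₀, hmult k E₀ f₀ a w hJ hw hf₀⟩

/-- [OURS · L1 W4.6; NOT a statement of the manuscript] o1's typed rung `ForcedAtomTerminates p K n` (p517839) over a
FINITE field `K`, `0 < n`, for every notion instance and reading (via res-L1-s46-pv-1's `terminates_of_permissiblyTerminates`).
[folklore] -/
theorem forcedAtomTerminates_of_finite (hK : Finite K) (hn : 0 < n) : ForcedAtomTerminates p K n :=
  fun _ N Rd => terminates_of_permissiblyTerminates N Rd (permissiblyTerminates_forcedAtom_of_finite hK hn)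

/-- [OURS · L1 W4.6; NOT a statement of the manuscript] … and its ∇-centred twin `ForcedAtomTerminatesNabla p K n` over a
finite field. [folklore] -/
theorem forcedAtomTerminatesNabla_of_finite (hK : Finite K) (hn : 0 < n) : ForcedAtomTerminatesNabla p K n :=
  forcedAtomTerminatesNabla_of_terminates (forcedAtomTerminates_of_finite hK hn)

/-- [OURS · L1 W4.6 rung (i) WITH A NUMBER over FINITE fields; NOT a statement of the manuscript] **The Milnor exit
bound `FinLocalExitBound (Regime.forcedAtom n)` over a finite field `K` of characteristic `p`**, `0 < n`, `n ≤ 2 ∨ p = 2`.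
Proof verbatim that of `finLocalExitBound_forcedAtom` (p524336) with the one step `exists_presentation_transform_of_finite`.
[folklore] -/
theorem finLocalExitBound_forcedAtom_of_finite (hK : Finite K) (hn : 0 < n) (hreg : n ≤ 2 ∨ p = 2) :
    FinLocalExitBound (Regime.forcedAtom (p := p) (K := K) n) := by
  haveI := hK
  have hp : p.Prime := Fact.out
  -- the bound: the Milnor number of a chosen atom presentation at `x`, if any
  refine ⟨fun A E x =>
    if h : ∃ (E₀ : AdicCompletion (maximalIdeal (A.Z.presheaf.stalk x)) (A.Z.presheaf.stalk x) ≃+*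
          MvPowerSeries (Option (Fin n)) K)
        (f₀ : A.Z.presheaf.stalk x) (c₀ : (Fin n → ℕ) → K) (w₀ : MvPowerSeries (Option (Fin n)) K),
        stalkIdeal E.J x = Ideal.span {f₀} ∧ IsUnit w₀ ∧
          E₀ (algebraMap _ _ f₀) = w₀ * ((X none : MvPowerSeries (Option (Fin n)) K) ^ p -
            rename (some : Fin n → Option (Fin n)) (ser p n K c₀))
      then mu p n K h.choose_spec.choose_spec.choose else 0, ?_⟩
  intro r hr x s hs
  -- the empty case
  rcases s.eq_empty_or_nonempty with hs0 | ⟨m₀, hm₀⟩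
  · rw [hs0, Finset.card_empty]
    exact Nat.zero_le _
  have hlen : 0 < r.len := lt_of_le_of_lt (Nat.zero_le m₀) (hs m₀ hm₀).1
  -- singular points and centres of the stages `k < len`
  have hS : ∀ k, k ≤ r.len → (r.E k).sing.Subsingleton := fun k hk => (hr k hk).2.1
  have hcen : ∀ k, k < r.len → ∃ ξ : (r.A k).Z, (r.D k : Set (r.A k).Z) = {ξ} ∧ (r.E k).sing = {ξ} := by
    intro k hk
    obtain ⟨ξ, hξD⟩ := (r.permissible k hk).irreducible.nonempty
    have hξS : ξ ∈ (r.E k).sing := (r.permissible k hk).subset_sing hξD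
    refine ⟨ξ, ?_, (hS k hk.le).eq_singleton_of_mem hξS⟩
    exact (Set.subsingleton_of_subset_singleton
      (((hS k hk.le).eq_singleton_of_mem hξS) ▸ (r.permissible k hk).subset_sing)).eq_singleton_of_mem hξD
  choose ξ hξ using hcen
  have hξS : ∀ k (hk : k < r.len), ξ k hk ∈ (r.E k).sing := fun k hk => by
    rw [(hξ k hk).2]
    exact Set.mem_singleton _
  -- every stalk at a singular point of a stage `k ≤ len` is presented, so its residue field is `K`
  have hres : ∀ k (hk : k < r.len), Nonempty (ResidueField ((r.A k).Z.presheaf.stalk (ξ k hk)) ≃+* K) := by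
    intro k hk
    haveI : IsRegularLocalRing ((r.A k).Z.presheaf.stalk (ξ k hk)) := ambient_isRegular (r.A k) _
    obtain ⟨E₀, -, -, -, -⟩ := ((hr k hk.le).2.2 (ξ k hk) (hξS k hk)).2.1
    exact nonempty_residueField_equiv_of_presentation E₀
  -- consecutive singular points lie over each other
  have hπξ : ∀ k (hk : k + 1 < r.len), r.π k (ξ (k + 1) hk) = ξ k (Nat.lt_of_succ_lt hk) := by
    intro k hk
    haveI : IsLocallyNoetherian (r.A (k + 1)).Z := ambient_isLocallyNoetherian _
    have hk' : k < r.len := Nat.lt_of_succ_lt hk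
    have h1 : ξ (k + 1) hk ∈ ((r.E k).transform (r.π k) (r.D k)).sing := by
      rw [← r.E_succ k hk']
      exact hξS (k + 1) hk
    exact hS k hk'.le (sing_subset_of_transform (r.blowup k hk') (r.E k) (r.permissible k hk').subset_sing h1)
      (hξS k hk')
  have hdown : ∀ k (hk : k < r.len), r.down k (ξ k hk) = ξ 0 hlen := by
    intro k
    induction k with
    | zero => intro hk; rfl
    | succ k ih =>
      intro hk
      change (r.π k ≫ r.down k) (ξ (k + 1) hk) = ξ 0 hlen
      rw [Scheme.Hom.comp_apply, hπξ k hk, ih]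
  -- `x` is the singular point of stage `0`
  have hx : x = ξ 0 hlen := by
    obtain ⟨hm₀len, y, hy, hyx⟩ := hs m₀ hm₀
    rw [(hξ m₀ hm₀len).1, Set.mem_singleton_iff] at hy
    rw [← hyx, hy, hdown m₀ hm₀len]
  subst hx
  -- the chosen presentation at `ξ 0`
  have hex := ((hr 0 hlen.le).2.2 (ξ 0 hlen) (hξS 0 hlen)).2.1
  dsimp only
  rw [dif_pos hex]
  set c₀ := hex.choose_spec.choose_spec.choose with hc₀def
  have hpres₀ := hex.choose_spec.choose_spec.choose_spec
  obtain ⟨w₀, hJ0, hw0, hf0⟩ := hpres₀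
  -- multiplicity `p` of a presented atom at a singular point of a stage in the regime
  have hmult : ∀ (k : ℕ) (hk : k < r.len)
      (E₀ : AdicCompletion (maximalIdeal ((r.A k).Z.presheaf.stalk (ξ k hk))) ((r.A k).Z.presheaf.stalk (ξ k hk)) ≃+*
        MvPowerSeries (Option (Fin n)) K)
      (f₀ : (r.A k).Z.presheaf.stalk (ξ k hk)) (a : (Fin n → ℕ) → K) (w : MvPowerSeries (Option (Fin n)) K),
      stalkIdeal (r.E k).J (ξ k hk) = Ideal.span {f₀} → IsUnit w →
        E₀ (algebraMap _ _ f₀) = w * ((X none : MvPowerSeries (Option (Fin n)) K) ^ p -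
          rename (some : Fin n → Option (Fin n)) (ser p n K a)) → Isol p n K a ∧ MultP p n K a := by
    intro k hk E₀ f₀ a w hJ hw hf₀
    haveI : IsRegularLocalRing ((r.A k).Z.presheaf.stalk (ξ k hk)) := ambient_isRegular (r.A k) _
    have hI : Isol p n K a := ((hr k hk.le).2.2 (ξ k hk) (hξS k hk)).2.2 E₀ f₀ a w hJ hw hf₀
    have hf₀𝔪 : f₀ ∈ maximalIdeal ((r.A k).Z.presheaf.stalk (ξ k hk)) ^ p := by
      have h := hξS k hk
      change ((r.E k).b : ℕ∞) ≤ idealOrder (r.E k).J _ at h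
      rw [le_idealOrder_iff, hJ, Ideal.span_singleton_le_iff_mem, (hr k hk.le).1] at h
      exact h
    exact ⟨hI, (transform_mem_pow_iff_multP E₀ hw a hf₀).2.mpr ⟨ThreefoldsCharTwo.ser_ne_zero_of_isol hn hI, hf₀𝔪⟩⟩
  -- presentations at `ξ_k`, `k < len`
  let P : ∀ k, k < r.len → Type := fun k hk =>
    Σ' (E₀ : AdicCompletion (maximalIdeal ((r.A k).Z.presheaf.stalk (ξ k hk))) ((r.A k).Z.presheaf.stalk (ξ k hk)) ≃+*
        MvPowerSeries (Option (Fin n)) K)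
      (f₀ : (r.A k).Z.presheaf.stalk (ξ k hk)) (a : (Fin n → ℕ) → K) (w : MvPowerSeries (Option (Fin n)) K),
      stalkIdeal (r.E k).J (ξ k hk) = Ideal.span {f₀} ∧ IsUnit w ∧
        E₀ (algebraMap _ _ f₀) = w * ((X none : MvPowerSeries (Option (Fin n)) K) ^ p -
          rename (some : Fin n → Option (Fin n)) (ser p n K a))
  -- one run of the coefficient dynamics presenting every stage `k < len`
  have H : ∀ k (hk : k < r.len), ∃ (i : ℕ → Fin n) (t : ℕ → Fin n → K) (q : P k hk),
      run p n K c₀ i t k = q.2.2.1 ∧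
        ∀ j ≤ k, Isol p n K (run p n K c₀ i t j) ∧ MultP p n K (run p n K c₀ i t j) := by
    intro k
    induction k with
    | zero =>
      intro hk
      refine ⟨fun _ => ⟨0, hn⟩, fun _ _ => 0, ⟨hex.choose, hex.choose_spec.choose, c₀, w₀, hJ0, hw0, hf0⟩, rfl, ?_⟩
      intro j hj
      obtain rfl : j = 0 := Nat.le_zero.mp hj
      exact hmult 0 hk hex.choose hex.choose_spec.choose c₀ w₀ hJ0 hw0 hf0
    | succ k ih =>
      intro hk
      have hk' : k < r.len := Nat.lt_of_succ_lt hk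
      obtain ⟨i, t, ⟨E₀, f₀, a, w, hJ, hw, hf₀⟩, hrun, hgood⟩ := ih hk'
      have hd := ((hr k hk'.le).2.2 (ξ k hk') (hξS k hk')).1
      have hξ' : ξ (k + 1) hk ∈ ((r.E k).transform (r.π k) (r.D k)).sing := by
        rw [← r.E_succ k hk']
        exact hξS (k + 1) hk
      obtain ⟨i₀, τ, E₀', f₀', w', hJ', hw', hf₀'⟩ := exists_presentation_transform_of_finite (r.π k) (r.D k)
        (r.blowup k hk') (hr k hk'.le).1 (hS k hk'.le) (hξS k hk') (hξ k hk').1 hd E₀ f₀ a w hJ hw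
        hf₀ (hmult k hk' E₀ f₀ a w hJ hw hf₀).2 hξ' (hres (k + 1) hk)
      have hJ'' : stalkIdeal (r.E (k + 1)).J (ξ (k + 1) hk) = Ideal.span {f₀'} := by
        rw [r.E_succ k hk']
        exact hJ'
      -- the extended word
      refine ⟨fun j => if j = k then i₀ else i j, fun j => if j = k then τ else t j,
        ⟨E₀', f₀', step p n K i₀ τ a, w', hJ'', hw', hf₀'⟩, ?_, ?_⟩
      · have hagree : run p n K c₀ (fun j => if j = k then i₀ else i j) (fun j => if j = k then τ else t j) k =
            run p n K c₀ i t k :=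
          run_congr c₀ k (fun j hj => if_neg (Nat.ne_of_lt hj)) (fun j hj => if_neg (Nat.ne_of_lt hj))
        change step p n K (if k = k then i₀ else i k) (if k = k then τ else t k)
          (run p n K c₀ (fun j => if j = k then i₀ else i j) (fun j => if j = k then τ else t j) k) = _
        rw [if_pos rfl, if_pos rfl, hagree, hrun]
      · intro j hj
        rcases Nat.lt_or_ge j (k + 1) with hjk | hjk
        · have hjk' : j ≤ k := Nat.lt_succ_iff.mp hjk
          have hagree_j : run p n K c₀ (fun l => if l = k then i₀ else i l) (fun l => if l = k then τ else t l) j =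
              run p n K c₀ i t j :=
            (run_congr c₀ j (i' := fun l => if l = k then i₀ else i l) (t' := fun l => if l = k then τ else t l)
              (fun l hl => (if_neg (Nat.ne_of_lt (lt_of_lt_of_le hl hjk'))).symm)
              (fun l hl => (if_neg (Nat.ne_of_lt (lt_of_lt_of_le hl hjk'))).symm)).symm
          rw [hagree_j]
          exact hgood j hjk'
        · have hj' : j = k + 1 := le_antisymm hj hjk
          subst hj'
          have hagree : run p n K c₀ (fun j => if j = k then i₀ else i j) (fun j => if j = k then τ else t j) k =
              run p n K c₀ i t k :=
            run_congr c₀ k (fun j hj => if_neg (Nat.ne_of_lt hj)) (fun j hj => if_neg (Nat.ne_of_lt hj))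
          have hstate : run p n K c₀ (fun j => if j = k then i₀ else i j) (fun j => if j = k then τ else t j)
              (k + 1) = step p n K i₀ τ a := by
            change step p n K (if k = k then i₀ else i k) (if k = k then τ else t k)
              (run p n K c₀ (fun j => if j = k then i₀ else i j) (fun j => if j = k then τ else t j) k) = _
            rw [if_pos rfl, if_pos rfl, hagree, hrun]
          rw [hstate]
          exact hmult (k + 1) hk E₀' f₀' (step p n K i₀ τ a) w' hJ'' hw' hf₀'
  -- the last blown-up stage `len - 1` and the Milnor bound
  obtain ⟨i, t, -, -, hgood⟩ := H (r.len - 1) (Nat.sub_lt hlen Nat.one_pos)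
  obtain ⟨m, hmμ, hbad⟩ := classicalRegimes_exit_le_mu hp hn hreg K c₀ i t
  have hlenm : r.len ≤ m := by
    by_contra hlt
    exact hbad (hgood m (by omega))
  -- `s ⊆ {0, …, len - 1}`
  have hcard : s.card ≤ r.len := by
    calc s.card ≤ (Finset.range r.len).card :=
          Finset.card_le_card fun m hm => Finset.mem_range.mpr (hs m hm).1
      _ = r.len := Finset.card_range _
  exact hcard.trans (hlenm.trans hmμ)


end FiniteField

/-! ## Summary: the forced-atom rungs over every algebraically closed OR finite field -/

/-- [OURS · L1 W4.6 rung (i)/(all `n ≥ 1`) — SUMMARY; NOT a statement of the manuscript] Over a field `K` of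
characteristic `p` that is ALGEBRAICALLY CLOSED OR FINITE, `0 < n`: no infinite §2.1-permissible sequence inside
`Regime.forcedAtom n` (p523688 / this file). [folklore] -/
theorem permissiblyTerminates_forcedAtom_of_isAlgClosed_or_finite (hK : IsAlgClosed K ∨ Finite K) (hn : 0 < n) :
    PermissiblyTerminates (Regime.forcedAtom (p := p) (K := K) n) := by
  rcases hK with hK | hK
  · haveI := hK
    exact permissiblyTerminates_forcedAtom hn
  · exact permissiblyTerminates_forcedAtom_of_finite hK hn

/-- [OURS · L1 W4.6 rung (i)/(all `n ≥ 1`) — SUMMARY; NOT a statement of the manuscript] o1's typed rung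
`ForcedAtomTerminates p K n` (p517839) over every algebraically closed or finite field `K` of characteristic `p`, `0 < n`.
[folklore] -/
theorem forcedAtomTerminates_of_isAlgClosed_or_finite (hK : IsAlgClosed K ∨ Finite K) (hn : 0 < n) :
    ForcedAtomTerminates p K n :=
  fun _ N Rd => terminates_of_permissiblyTerminates N Rd (permissiblyTerminates_forcedAtom_of_isAlgClosed_or_finite hK hn)

/-- [OURS · L1 W4.6 rung (i) WITH A NUMBER — SUMMARY; NOT a statement of the manuscript] The Milnor exit bound
`FinLocalExitBound (Regime.forcedAtom n)` over every algebraically closed or finite field `K` of characteristic `p`,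
`0 < n`, `n ≤ 2 ∨ p = 2` (p524336 / this file). [folklore] -/
theorem finLocalExitBound_forcedAtom_of_isAlgClosed_or_finite (hK : IsAlgClosed K ∨ Finite K) (hn : 0 < n)
    (hreg : n ≤ 2 ∨ p = 2) : FinLocalExitBound (Regime.forcedAtom (p := p) (K := K) n) := by
  rcases hK with hK | hK
  · haveI := hK
    exact finLocalExitBound_forcedAtom hn hreg
  · exact finLocalExitBound_forcedAtom_of_finite hK hn hreg

end CampaignW46.ForcedAtom

end Summit.ResolutionOfSingularities.ResolutionOfSingularities.Theorems

end
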